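import Literature.Topology.FourManifolds.TracePolarChart
import Literature.Topology.FourManifolds.PairSaddleCover
import HarnessLib

/-!
# The trace circles of the saddles on the boundary, and the unit circle of the flow-polar charts

Topic `Literature/Topology/FourManifolds` (support file for the Torelli half of Griffiths'
handlebody theorem, `stmt-SmoothPoincare4-15190`, after `TracePolarChart.lean`).
Everything here is **proved**; the one new definition is the trace of a saddle.

Milnor, *Lectures on the h-cobordism theorem* (1965), Def. 3.9 (PDF p. 16) and proof of
Thm. 3.12 (PDF p. 18): the trajectories leaving a critical point `q` of index `λ` sweep out its
"right-hand disc", whose points leave every Milnor box of `q` through the sphere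
`{x⃗ = 0, |y⃗| = const}`.  For a basin setting `B` on a compact manifold with boundary `W` and
a saddle `s` (critical point other than the minimum `p₀`) we define

* `BasinSetting.traceOf B s` — **the trace of `s` on `∂W`**: the boundary points lying on
  trajectories coming from `s` (`unstableSet`); the traces of distinct saddles are disjoint
  (`disjoint_traceOf`), and the set of all traces of `BasinFlow.lean` is their union
  (`mem_traces_iff_exists_traceOf`);

and for saddle data `Q` of a pair of basin settings in dimension `3` and a saddle of index `1`
we identify the trace with **the unit circle of the flow-polar chart** (`TracePolarChart.lean`):
the trace lies in the source of the chart (`traceOf_subset_polSource`), and a point of the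
source lies on the trace iff its exit point lies on the unstable disc of the box iff its
flow-polar coordinates have norm one (`mem_traceOf_iff_sqSumLT_eq_zero`,
`norm_polInv_eq_one_iff`, `pol_mem_traceOf_iff`).

## References

* J. Milnor, *Lectures on the h-cobordism theorem* (1965), Def. 3.9, proofs of Thms. 3.12–3.13
  (PDF pp. 16–19). [MilnorHCobordism1965]
* H. B. Griffiths, *Automorphisms of a 3-dimensional handlebody*, Abh. Math. Sem. Univ. Hamburg
  26 (1964), §3. [GriffithsHB1964Handlebody]
-/

open scoped Manifold ContDiff Topology
open Set Function Filter Metric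

noncomputable section

namespace Literature.Topology.FourManifolds

open Cobordism FourManifolds.Flow TracePolar

universe u

/-! ### The trace of a saddle on the boundary -/

namespace BasinSetting

variable {n : ℕ} {W : Type u} [TopologicalSpace W] [T2Space W] [SecondCountableTopology W]
  [CompactSpace W] [ChartedSpace (EuclideanHalfSpace (n + 1)) W] [IsManifold (𝓡∂ (n + 1)) ∞ W]
  {g : W → ℝ} {ξ : Π x : W, TangentSpace (𝓡∂ (n + 1)) x} (B : BasinSetting g ξ)

/-- **The trace of the saddle `s` on `∂W`**: the boundary points on trajectories coming from
`s` (read through the push to the level `L`, which lies on the same trajectory). [cite: MilnorHCobordism1965, Def. 3.9 (PDF p. 16)] -/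
def traceOf (s : SaddlePt n g) : Set ((𝓡∂ (n + 1)).boundary W) :=
  {y | B.push (y : W) ∈ unstableSet (𝓡∂ (n + 1)) ξ s.1}

variable {B}

/-- **Membership in the trace**: the boundary point lies on a trajectory coming from `s`. [cite: MilnorHCobordism1965, Def. 3.9 (PDF p. 16)] -/
theorem mem_traceOf_iff {s : SaddlePt n g} {y : (𝓡∂ (n + 1)).boundary W} :
    y ∈ B.traceOf s ↔ (y : W) ∈ unstableSet (𝓡∂ (n + 1)) ξ s.1 :=
  (B.coe_mem_unstableSet_iff y s.1).symm

/-- **A boundary point lies on the trace of `s` iff the backward trajectory of its push converges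
to `s`.** [cite: MilnorHCobordism1965, Def. 3.9 (PDF p. 16)] -/
theorem mem_traceOf_iff_tendsto {s : SaddlePt n g} {y : (𝓡∂ (n + 1)).boundary W} :
    y ∈ B.traceOf s ↔ Tendsto (fun t => B.θ (t, B.push (y : W))) atBot (𝓝 s.1) :=
  B.preSlabFlow.mem_unstableSet_iff_tendsto (by rw [B.apply_push_coe]; exact B.L_lt_hi.le)
    (B.lo_lt_apply s.1).le

/-- **The traces of distinct saddles are disjoint.** [folklore] -/
theorem disjoint_traceOf {s s' : SaddlePt n g} (h : s ≠ s') : Disjoint (B.traceOf s) (B.traceOf s') := by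
  rw [Set.disjoint_left]
  intro y hy hy'
  rw [mem_traceOf_iff_tendsto] at hy hy'
  exact h (Subtype.ext (tendsto_nhds_unique hy hy'))

/-- **The traces of `BasinFlow.lean` are the union of the traces of the saddles.** [cite: MilnorHCobordism1965, Def. 3.9, Cor. 3.5] -/
theorem mem_traces_iff_exists_traceOf {y : (𝓡∂ (n + 1)).boundary W} : y ∈ B.traces ↔ ∃ s, y ∈ B.traceOf s := by
  have hyL : g (B.push (y : W)) ≤ B.hi := by rw [B.apply_push_coe]; exact B.L_lt_hi.le
  constructor
  · intro hy
    obtain ⟨p, hp, -, hconv, hmem⟩ := B.exists_tendsto_atBot hyL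
    have hpne : p ≠ B.p₀ := fun h => by
      apply hy
      rw [mem_basin_iff, B.coe_mem_unstableSet_iff, ← h]; exact hmem
    exact ⟨⟨p, hp, B.morseIndex_ne_zero hp hpne⟩, hmem⟩
  · rintro ⟨s, hs⟩
    rw [mem_traces_iff]
    intro hb
    rw [mem_basin_iff, B.coe_mem_unstableSet_iff] at hb
    have h1 : Tendsto (fun t => B.θ (t, B.push (y : W))) atBot (𝓝 B.p₀) := (B.mem_basin_iff_tendsto hyL).1 hb
    exact B.coe_ne_p₀ s (tendsto_nhds_unique (mem_traceOf_iff_tendsto.1 hs) h1)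

/-- A point of a trace is not in the basin. [folklore] -/
theorem mem_traces_of_mem_traceOf {s : SaddlePt n g} {y : (𝓡∂ (n + 1)).boundary W} (hy : y ∈ B.traceOf s) :
    y ∈ B.traces := mem_traces_iff_exists_traceOf.2 ⟨s, hy⟩

end BasinSetting

/-! ### The trace circle is the unit circle of the flow-polar chart -/

namespace BasinPair

namespace SaddleData

variable {W : Type u} [TopologicalSpace W] [T2Space W] [SecondCountableTopology W]
  [CompactSpace W] [ChartedSpace (EuclideanHalfSpace (2 + 1)) W] [IsManifold (𝓡∂ (2 + 1)) ∞ W]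
  {g : W → ℝ} {ξA ξB : Π x : W, TangentSpace (𝓡∂ (2 + 1)) x} {P : BasinPair g ξA ξB}
  (Q : P.SaddleData)

/-- Local notation for the model plane. -/
local notation "E2" => EuclideanSpace ℝ (Fin 2)

/-- On the unstable axis (`x⃗ = 0`, `y⃗ ≠ 0`) the model flow reaches any prescribed `|y⃗|² = B' > 0`. [cite: MilnorHCobordism1965, proof of Thm. 3.12 (PDF p. 18)] -/
theorem exists_sqSumGE_milnorFlow_eq' {m : ℕ} (k : ℕ) {u : EuclideanSpace ℝ (Fin m)}
    (ha : sqSumLT k u = 0) (hb : 0 < sqSumGE k u) {B' : ℝ} (hB : 0 < B') :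
    ∃ t : ℝ, sqSumLT k (milnorFlow k t u) = 0 ∧ sqSumGE k (milnorFlow k t u) = B' := by
  refine ⟨Real.log (B' / sqSumGE k u) / 2, by rw [sqSumLT_milnorFlow, ha, mul_zero], ?_⟩
  rw [sqSumGE_milnorFlow, ← Real.exp_nat_mul]
  rw [show ((2 : ℕ) : ℝ) * (Real.log (B' / sqSumGE k u) / 2) = Real.log (B' / sqSumGE k u) by push_cast; ring,
    Real.exp_log (div_pos hB hb), div_mul_cancel₀ _ hb.ne']

/-- A vector with `|x⃗|² + |y⃗|² < R²` has norm `< R` (`R ≥ 0`). [folklore] -/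
theorem norm_lt_of_sqSum_lt' {m : ℕ} (k : ℕ) {v : EuclideanSpace ℝ (Fin m)} {R : ℝ} (hR : 0 ≤ R)
    (h : sqSumLT k v + sqSumGE k v < R ^ 2) : ‖v‖ < R := by
  rw [sqSumLT_add_sqSumGE] at h
  exact (pow_lt_pow_iff_left₀ (norm_nonneg _) hR two_ne_zero).1 h

variable {Q}

/-- **Exit through the exit circle.**  If the backward `ξ_A`-trajectory of a non-critical point
`x` below `hi` converges to the saddle `s`, then the trajectory of `x` passes through a point
`z` of the exit level `c + ε²` lying in every exit set of `s` and on the unstable disc of the box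
(`|x⃗|² = 0`), and `x` lies above `c`. [cite: MilnorHCobordism1965, Def. 3.9, proof of Thm. 3.12 (PDF pp. 16–18)] -/
theorem exists_exit_of_tendsto_atBot {s : SaddlePt 2 g} {x : W} (hx : g x < P.A.hi)
    (hxc : ¬ IsMCriticalPt (𝓡∂ (2 + 1)) g x) (hconv : Tendsto (fun τ => P.A.θ (τ, x)) atBot (𝓝 s.1)) :
    ∃ T : ℝ, P.A.θ (T, x) ∈ (Q.DA s).chartBall (3 * Q.ε) ∧ g (P.A.θ (T, x)) = Q.exitLevel ∧
      sqSumLT (Q.DA s).k ((Q.DA s).coord (P.A.θ (T, x))) = 0 ∧ Q.c < g x := by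
  have hε := Q.ε_pos
  have hps : g s.1 = Q.c := Q.apply_eq_c s
  -- eventually on the unstable disc of the box of `s`
  obtain ⟨T₀, hbox, hA⟩ := (Q.DA s).exists_mem_box_sqSumLT_eq_zero_of_tendsto_atBot P.A.isFlowOf_X (x := x) hconv
  set p₁ := P.A.θ (T₀, x) with hp₁
  set u := (Q.DA s).coord p₁ with hu
  have hB : 0 < sqSumGE (Q.DA s).k u := by
    have h := Q.sqSum_pos_of_not_isMCriticalPt hxc T₀ hbox.1
    rw [← hu, hA, zero_add] at h; exact h
  have hp₁ball : p₁ ∈ (Q.DA s).chartBall (3 * (Q.DA s).ε) := by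
    refine ⟨hbox.1, norm_lt_of_sqSum_lt' (Q.DA s).k (by linarith [(Q.DA s).eps_pos]) ?_⟩
    have h := hbox.2.2
    rw [← hu, hA, zero_add]; nlinarith [(Q.DA s).eps_pos]
  -- move along the unstable axis to `|y⃗|² = ε²`, i.e. to the level `c + ε²`
  obtain ⟨t, htA, htB⟩ := exists_sqSumGE_milnorFlow_eq' (Q.DA s).k hA hB (pow_pos hε 2)
  have hnorm : ‖milnorFlow (Q.DA s).k t u‖ < 3 * (Q.DA s).ε := by
    refine norm_lt_of_sqSum_lt' (Q.DA s).k (by linarith [(Q.DA s).eps_pos]) ?_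
    rw [htA, htB, zero_add, Q.εA]; nlinarith
  set z := P.A.θ (t, p₁) with hz
  have hzball : z ∈ (Q.DA s).chartBall (3 * (Q.DA s).ε) :=
    (Q.DA s).flow_mem_chartBall P.A.isSmoothFlow_X P.A.contMDiff_X hp₁ball hnorm
  have hzcoord : (Q.DA s).coord z = milnorFlow (Q.DA s).k t u :=
    (Q.DA s).coord_flow P.A.isSmoothFlow_X P.A.contMDiff_X hp₁ball hnorm
  have hzℓ : g z = Q.exitLevel := by
    rw [exitLevel, hz, (Q.DA s).apply_flow P.A.isSmoothFlow_X P.A.contMDiff_X hp₁ball hnorm, milnorQuadratic_eq,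
      htA, htB, hps]; ring
  have hzx : z = P.A.θ (t + T₀, x) := by rw [hz, hp₁, P.A.θ_add]
  -- `g x > c`
  have hxc' : Q.c < g x := by
    have hgc : Continuous g := P.A.isMorseFunction.isMorse.contMDiff.continuous
    have hlim : Tendsto (fun τ => g (P.A.θ (τ, x))) atBot (𝓝 Q.c) := by rw [← hps]; exact (hgc.tendsto _).comp hconv
    have hge : ∀ τ, Q.c ≤ g (P.A.θ (τ, x)) := fun τ => (P.A.monotone_apply_θ x).le_of_tendsto hlim τ
    refine lt_of_le_of_ne (by simpa [P.A.θ_zero] using hge 0) fun heq => ?_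
    have hfix : ∀ τ, τ ≤ 0 → P.A.θ (τ, x) = x := fun τ hτ =>
      P.A.θ_eq_of_apply_eq hxc (P.A.apply_mem_slab hx)
        (le_antisymm (by simpa [P.A.θ_zero] using P.A.monotone_apply_θ x hτ) (heq ▸ hge τ))
    have hconst : Tendsto (fun τ => P.A.θ (τ, x)) atBot (𝓝 x) :=
      tendsto_const_nhds.congr' (by filter_upwards [eventually_le_atBot (0 : ℝ)] with τ hτ using (hfix τ hτ).symm)
    have := tendsto_nhds_unique hconv hconst
    exact hxc (this ▸ s.2.1)
  refine ⟨t + T₀, ?_, by rw [← hzx]; exact hzℓ, by rw [← hzx, hzcoord]; exact htA, hxc'⟩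
  rw [← hzx]; rw [Q.εA] at hzball; exact hzball

/-- **The trace of `s` lies in the source of the flow-polar chart of `s`**, and the exit point of
a trace point lies on the unstable disc of the box. [cite: MilnorHCobordism1965, Def. 3.9, proof of Thm. 3.12 (PDF pp. 16–18)] -/
theorem mem_polSource_of_mem_traceOf {s : SaddlePt 2 g} {y : (𝓡∂ (2 + 1)).boundary W} (hy : y ∈ P.A.traceOf s) :
    y ∈ Q.polSource s ∧ sqSumLT (Q.DA s).k ((Q.DA s).coord (Q.Zpt y)) = 0 := by
  set x := P.A.push (y : W) with hx
  have hxL : g x = P.A.L := P.A.apply_push_coe y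
  have hconv := BasinSetting.mem_traceOf_iff_tendsto.1 hy
  obtain ⟨T, hball, hℓ, hA, -⟩ := Q.exists_exit_of_tendsto_atBot (x := x) (by rw [hxL]; exact P.A.L_lt_hi)
    (P.A.not_isMCriticalPt_of_eq_L hxL) hconv
  have hZ : Q.Zpt y = P.A.θ (T, x) :=
    P.levelProj_A_eq_θ (P.A.not_isMCriticalPt_of_eq_L hxL) Q.exitLevel_mem_Ioo_p₀ hℓ
  refine ⟨?_, by rw [hZ]; exact hA⟩
  rw [mem_polSource_iff, hZ]
  exact ⟨hball, by rw [hA]; exact Q.sq_pos⟩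

/-- The trace lies in the source. [folklore] -/
theorem traceOf_subset_polSource (s : SaddlePt 2 g) : P.A.traceOf s ⊆ Q.polSource s := fun _ hy =>
  (Q.mem_polSource_of_mem_traceOf hy).1

/-- **A point of the source lies on the trace of `s` iff its exit point lies on the unstable
disc of the box** (`|x⃗|² = 0`). [cite: MilnorHCobordism1965, Def. 3.9, proof of Thm. 3.12 (PDF pp. 16–18)] -/
theorem mem_traceOf_iff_sqSumLT_eq_zero {s : SaddlePt 2 g} {y : (𝓡∂ (2 + 1)).boundary W} (hy : y ∈ Q.polSource s) :
    y ∈ P.A.traceOf s ↔ sqSumLT (Q.DA s).k ((Q.DA s).coord (Q.Zpt y)) = 0 := by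
  refine ⟨fun h => (Q.mem_polSource_of_mem_traceOf h).2, fun hA => ?_⟩
  -- the exit point lies on the unstable disc, so its backward orbit converges to `s`
  have hz := hy.1
  have hlev := Q.apply_eq_of_mem_chartBall hz
  rw [Q.apply_Zpt, exitLevel, milnorQuadratic_eq, hA] at hlev
  have hB : sqSumGE (Q.DA s).k ((Q.DA s).coord (Q.Zpt y)) ≤ 4 * (Q.DA s).ε ^ 2 := by
    rw [Q.εA]; nlinarith [Q.sq_pos]
  have h1 : Tendsto (fun t => P.A.θ (t, Q.Zpt y)) atBot (𝓝 s.1) :=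
    (Q.DA s).tendsto_atBot_of_sqSumLT_eq_zero P.A.isFlowOf_X hz.1 hA hB
  -- `Zpt y` lies on the orbit of `push y`
  rw [BasinSetting.mem_traceOf_iff_tendsto]
  have h2 : Q.Zpt y = P.A.θ (hittingTime P.A.θ g Q.exitLevel (P.A.push (y : W)), P.A.push (y : W)) := by
    rw [Zpt_def, levelProj_apply]
  rw [h2] at h1
  exact (P.A.tendsto_θ_atBot_iff _).1 h1

/-- **In flow-polar coordinates the trace is the unit circle**: a point of the source lies on
the trace iff its flow-polar coordinates have norm one. [cite: GriffithsHB1964Handlebody, §3] [cite: MilnorHCobordism1965, proof of Thm. 3.12] -/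
theorem norm_polInv_eq_one_iff {s : SaddlePt 2 g} (hk : (Q.DA s).k = 1) {y : (𝓡∂ (2 + 1)).boundary W}
    (hy : y ∈ Q.polSource s) : ‖Q.polInv s y‖ = 1 ↔ y ∈ P.A.traceOf s := by
  have hsh := milnorQuadratic_coord_Zpt hk hy
  have hne := polarOut_ne_zero Q.ε_pos hsh
  rw [Q.mem_traceOf_iff_sqSumLT_eq_zero hy, hk, sqSumLT_one, polInv_def,
    ← xco_eq_zero_iff Q.ε_pos hne, xco_polarOut Q.ε_pos hsh]
  exact ⟨fun h => by rw [h]; ring, fun h => pow_eq_zero_iff two_ne_zero |>.1 h⟩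

variable [Nonempty (BoundaryManifold.boundaryData 2 W).carrier]

/-- **The flow-polar boundary point of `w` lies on the trace iff `‖w‖ = 1`.** [cite: GriffithsHB1964Handlebody, §3] -/
theorem pol_mem_traceOf_iff {s : SaddlePt 2 g} (hk : (Q.DA s).k = 1) {w : E2} (hw : w ∈ Q.polTarget) :
    Q.pol s w ∈ P.A.traceOf s ↔ ‖w‖ = 1 := by
  rw [← Q.norm_polInv_eq_one_iff hk (pol_mem_polSource hk hw), polInv_pol hk hw]

/-- The unit circle is carried onto the trace. [folklore] -/
theorem pol_mem_traceOf {s : SaddlePt 2 g} (hk : (Q.DA s).k = 1) {w : E2} (hw : ‖w‖ = 1) : Q.pol s w ∈ P.A.traceOf s :=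
  (Q.pol_mem_traceOf_iff hk (Q.mem_polTarget_of_norm_eq_one hw)).2 hw

/-- Every trace point is the flow-polar boundary point of a unit vector. [folklore] -/
theorem exists_eq_pol_of_mem_traceOf {s : SaddlePt 2 g} (hk : (Q.DA s).k = 1) {y : (𝓡∂ (2 + 1)).boundary W}
    (hy : y ∈ P.A.traceOf s) : ∃ w : E2, ‖w‖ = 1 ∧ Q.pol s w = y :=
  ⟨Q.polInv s y, (Q.norm_polInv_eq_one_iff hk (Q.traceOf_subset_polSource s hy)).2 hy,
    pol_polInv hk (Q.traceOf_subset_polSource s hy)⟩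

/-- **The trace is the image of the unit circle under the flow-polar chart.** [cite: GriffithsHB1964Handlebody, §3] -/
theorem traceOf_eq_image_pol {s : SaddlePt 2 g} (hk : (Q.DA s).k = 1) :
    P.A.traceOf s = Q.pol s '' Metric.sphere (0 : E2) 1 := by
  ext y
  constructor
  · intro hy
    obtain ⟨w, hw, rfl⟩ := Q.exists_eq_pol_of_mem_traceOf hk hy
    exact ⟨w, by simpa using hw, rfl⟩
  · rintro ⟨w, hw, rfl⟩
    exact Q.pol_mem_traceOf hk (by simpa using hw)

end SaddleData

end BasinPair

end Literature.Topology.FourManifolds
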